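import Mathlib
import Literature.Computability.MetaComplexity.SmolenskyDimensionBound
import Literature.Computability.MetaComplexity.TruthTables

/-!
# One-sided low-degree certifiers of the sign of `λ` have large correlation with `λ`

Exact inequalities; wave-2 support of line Sketch/LAR (the inverse direction
`annRank ≤ correlation`), crux stmt-QuantumAdvantage-1392.

Write `val b = boolFunEquivFin n b < 2ⁿ` for the number with binary digits `b ∈ {0,1}ⁿ`,
`λ_b = λ(val b)` (Liouville), `t_b = (−1)^{[h b = 1]}` for a function `h : {0,1}ⁿ → 𝔽₂`, and
`supp h = {b : h b ≠ 0} = {b : h b = 1}`. Since `t_b = 1 − 2·[h b ≠ 0]`,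

  `Σ_b λ_b t_b = Σ_b λ_b − 2 Σ_{b ∈ supp h} λ_b`.

* If `h` vanishes wherever `λ_b = −1`, then on `supp h` we have `λ_b ∈ {0, 1}`, with `λ_b = 0`
  only at the single point `val b = 0`; hence `Σ_{supp h} λ_b ≥ #supp h − 1` and
  `Σ_b λ_b t_b ≤ Σ_b λ_b − 2·#supp h + 2`.
* If `h` vanishes wherever `λ_b ≠ −1`, then `λ_b = −1` on `supp h`, so
  `Σ_b λ_b t_b = Σ_b λ_b + 2·#supp h` (we record the inequality `≥`).

Both parts are proved pointwise (`CorrOneSided.pointwise_le`, `CorrOneSided.le_pointwise`) and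
summed over the cube (`Σ_b [h b ≠ 0] = #supp h`, and `Σ_b [val b = 0] = 1` since exactly one `b`
has `val b = 0` — the same reindexing as `CorrLeCard.sum_ite_val_eq_zero` of the sibling file
`…LARCorrLeCard`).
-/

namespace Summit.QuantumAdvantage.DigitPolyUniformity.SketchLAR

open Finset Module
open Literature.Computability.MetaComplexity (boolFunEquivFin)
open Literature.Computability.MetaComplexity.Smolensky (CubeFn mono lowDeg)

namespace CorrOneSided

/-- **Pointwise bound, part 1.** If `u ∈ 𝔽₂` vanishes when `λ(N) = −1`, then
`λ(N)·(−1)^{[u = 1]} ≤ λ(N) − 2·[u ≠ 0] + 2·[N = 0]`: for `u = 0` the two sides differ by the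
nonnegative last term; for `u = 1` we have `λ(N) ≠ −1`, so either `N = 0` (both sides `0`) or
`λ(N) = (−1)^{Ω(N)} = 1` (both sides `−1`). [folklore] -/
theorem pointwise_le (N : ℕ) (u : ZMod 2) (hu : ArithmeticFunction.liouville N = -1 → u = 0) :
    ((ArithmeticFunction.liouville N : ℤ) : ℝ) * (if u = 1 then (-1 : ℝ) else 1) ≤
      ((ArithmeticFunction.liouville N : ℤ) : ℝ) - 2 * (if u ≠ 0 then (1 : ℝ) else 0) +
        2 * (if N = 0 then (1 : ℝ) else 0) := by
  have hu2 : ∀ v : ZMod 2, v = 0 ∨ v = 1 := by decide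
  rcases eq_or_ne N 0 with rfl | hN
  · simp only [ArithmeticFunction.map_zero, Int.cast_zero, zero_mul, zero_sub, if_true, mul_one]
    rcases hu2 u with rfl | rfl <;> norm_num
  · simp only [hN, if_false, mul_zero, add_zero]
    -- `λ(N) = (−1)^{Ω(N)} ∈ {1, −1}` for `N ≠ 0`
    have hl : ArithmeticFunction.liouville N = 1 ∨ ArithmeticFunction.liouville N = -1 := by
      rw [ArithmeticFunction.liouville_apply hN]
      exact neg_one_pow_eq_or ℤ _
    rcases hl with hl | hl
    · rcases hu2 u with rfl | rfl <;> norm_num [hl]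
    · obtain rfl := hu hl
      norm_num [hl]

/-- **Pointwise bound, part 2.** If `u ∈ 𝔽₂` vanishes when `λ(N) ≠ −1`, then
`λ(N) + 2·[u ≠ 0] ≤ λ(N)·(−1)^{[u = 1]}`: for `u = 0` both sides are `λ(N)`; for `u = 1` we have
`λ(N) = −1` and both sides are `1`. [folklore] -/
theorem le_pointwise (N : ℕ) (u : ZMod 2) (hu : ArithmeticFunction.liouville N ≠ -1 → u = 0) :
    ((ArithmeticFunction.liouville N : ℤ) : ℝ) + 2 * (if u ≠ 0 then (1 : ℝ) else 0) ≤
      ((ArithmeticFunction.liouville N : ℤ) : ℝ) * (if u = 1 then (-1 : ℝ) else 1) := by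
  have hu2 : ∀ v : ZMod 2, v = 0 ∨ v = 1 := by decide
  rcases hu2 u with rfl | rfl
  · norm_num
  · have hl : ArithmeticFunction.liouville N = -1 := by
      by_contra hne
      exact absurd (hu hne) (by decide)
    norm_num [hl]

end CorrOneSided

/-- **W2: one-sided certifiers have large correlation with `λ` (exact inequalities).**
For `h : {0,1}ⁿ → 𝔽₂`, with `λ_b = λ(val b)`, `val b = boolFunEquivFin n b`, and
`supp h = {b : h b ≠ 0}`:
* if `h b = 0` whenever `λ_b = −1`, then `Σ_b λ_b (−1)^{[h b = 1]} ≤ Σ_b λ_b − 2·#supp h + 2`;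
* if `h b = 0` whenever `λ_b ≠ −1`, then `Σ_b λ_b + 2·#supp h ≤ Σ_b λ_b (−1)^{[h b = 1]}`.
(Sum the pointwise bounds `CorrOneSided.pointwise_le` / `CorrOneSided.le_pointwise` over the cube;
`Σ_b [h b ≠ 0] = #supp h`, and `Σ_b [val b = 0] = 1` by reindexing through the bijection
`boolFunEquivFin n` onto `{0, …, 2ⁿ − 1}`.) [folklore] -/
theorem stub_corr_oneSided {n : ℕ} (h : CubeFn (ZMod 2) n) :
    ((∀ b, ArithmeticFunction.liouville ((boolFunEquivFin n b : Fin (2 ^ n)) : ℕ) = -1 → h b = 0) →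
      ∑ b : Fin n → Bool, ((ArithmeticFunction.liouville ((boolFunEquivFin n b : Fin (2 ^ n)) : ℕ) : ℤ) : ℝ) *
          (if h b = 1 then (-1 : ℝ) else 1) ≤
        ∑ b : Fin n → Bool, ((ArithmeticFunction.liouville ((boolFunEquivFin n b : Fin (2 ^ n)) : ℕ) : ℤ) : ℝ) -
          2 * (univ.filter fun b => h b ≠ 0).card + 2) ∧
    ((∀ b, ArithmeticFunction.liouville ((boolFunEquivFin n b : Fin (2 ^ n)) : ℕ) ≠ -1 → h b = 0) →
      ∑ b : Fin n → Bool, ((ArithmeticFunction.liouville ((boolFunEquivFin n b : Fin (2 ^ n)) : ℕ) : ℤ) : ℝ) +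
          2 * (univ.filter fun b => h b ≠ 0).card ≤
        ∑ b : Fin n → Bool, ((ArithmeticFunction.liouville ((boolFunEquivFin n b : Fin (2 ^ n)) : ℕ) : ℤ) : ℝ) *
          (if h b = 1 then (-1 : ℝ) else 1)) := by
  constructor
  · -- part 1: sum `λ_b t_b ≤ λ_b − 2·[h b ≠ 0] + 2·[val b = 0]` over the cube
    intro H
    -- exactly one point of the cube has `val b = 0`: reindex `N = val b` over `{0, …, 2ⁿ − 1}`
    -- (same computation as `CorrLeCard.sum_ite_val_eq_zero` of the sibling file `…LARCorrLeCard`)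
    have h0 : ∑ b : Fin n → Bool,
        (if ((boolFunEquivFin n b : Fin (2 ^ n)) : ℕ) = 0 then (1 : ℝ) else 0) = 1 := by
      rw [Equiv.sum_comp (boolFunEquivFin n)
          (fun k : Fin (2 ^ n) => if (k : ℕ) = 0 then (1 : ℝ) else 0),
        Fin.sum_univ_eq_sum_range (fun N => if N = 0 then (1 : ℝ) else 0) (2 ^ n),
        Finset.sum_ite_eq' (range (2 ^ n)) 0 (fun _ => (1 : ℝ)), if_pos]
      exact mem_range.2 (Nat.two_pow_pos n)
    refine (Finset.sum_le_sum fun b _ =>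
      CorrOneSided.pointwise_le ((boolFunEquivFin n b : Fin (2 ^ n)) : ℕ) (h b) (H b)).trans_eq ?_
    rw [Finset.sum_add_distrib, Finset.sum_sub_distrib, ← Finset.mul_sum, ← Finset.mul_sum,
      h0, Finset.sum_boole, mul_one]
  · -- part 2: sum `λ_b + 2·[h b ≠ 0] ≤ λ_b t_b` over the cube
    intro H
    refine (Eq.le ?_).trans (Finset.sum_le_sum fun b _ =>
      CorrOneSided.le_pointwise ((boolFunEquivFin n b : Fin (2 ^ n)) : ℕ) (h b) (H b))
    rw [Finset.sum_add_distrib, ← Finset.mul_sum, Finset.sum_boole]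

end Summit.QuantumAdvantage.DigitPolyUniformity.SketchLAR
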